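import Summits.AtomisticToContinuum.Crystallization.Theorems.ChargedEnergyGapRotationRepair
import HarnessLib

/-!
(SPLIT FOR THE 400-LINE CAP by the landing lane, hand-2 g31: this file = part 1 of 5; sequels `…ChargedEnergyGapStressFreeFccB`, `…ChargedEnergyGapStressFreeFccC`, `…ChargedEnergyGapStressFreeFccD`, `…ChargedEnergyGapStressFreeFcc` import it in a chain; same namespace, all FQNs unchanged.)
# `ChargedEnergyGap` — the ROTATION GAUGE, addendum P-J: the STRESS-FREE FCC LATTICE is ADMISSIBLE — a kernel witness of the (H𝄪) hypothesis
# block minus stability AT THE RECORD DIALS (cell `decomp-a2c`, lens 3, generation 61, node «RotationGauge», part P-J = FCC-W; over part P-I(2/2)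
# `…Theorems.ChargedEnergyGapRotationRepair`, sibling of P-I(3/3) `…StressFreeCubic`)

WHAT THIS PART PROVES (every theorem PROVED; `Classical.choice` only through Mathlib).  Part P-I(3/3) witnessed the alarm's hypotheses on the simple
cubic lattice, which is NOT Barlow-labelled.  This part does it on the physically relevant reference: the face-centred cubic Lennard-Jones lattice
in CUBIC COORDINATES, `fccRef b` = lattice `b·D₃ = {b·x : x ∈ ℤ³, Σ xₖ even}` (basis `b(0,1,1), b(1,0,1), b(1,1,0)`, `Submodule.span ℤ`, Mathlib
`ZSpan` instances) with the one-point motif `{0}` (★ `mem_points_iff_even`, ★ `vecEquiv : D₃ ∖ 0 ≃ points ∖ 0`).  At the STRESS-FREE parameter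
★ `a₀ := (Z_{D₃}(12)/Z_{D₃}(6))^{1/6}` (`epsteinA`, `epsteinB` over `D₃ ∖ 0`; `a0_pow_six`) the configuration `fccRef a₀` satisfies, AT THE RECORD
DIALS `s = 3/5`, `lam = 1/3`, `ℓ = 3` of (H𝄪)/(H𝄪ʳ):
  ★★★ `fcc_witness : IsSeparatedRef (3/5) (fccRef a₀) ∧ IsLabelledRef (1/3) 3 (fccRef a₀) ∧ IsForceFree (fccRef a₀) ∧ IsStressFree (fccRef a₀)`,
  ★★★ `fccRef_not_harmStableWith : 0 < μ₀ → ¬ HarmStableWith μ₀ (fccRef a₀)` (the alarm of P-I(1/2) on this admissible reference), packaged as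
  ★★★ `exists_admissible_not_harmStableWith` — the WHOLE hypothesis block of the generation-53–56 piece (H𝄪) except `HarmStableWith` is
  SATISFIABLE at the record dials, and `HarmStableWith μ₀` fails there for every `μ₀ > 0`: protocol (V2) for the collapse verdict of P-I(1/2) is
  now met on an ADMISSIBLE reference (not only on the inadmissible cubic one), and the repaired piece (H𝄪ʳ) has its non-stability hypotheses
  witnessed in the kernel — the tag [hyps-unwitnessed] of P-I(2/2) shrinks to `HarmStableModRot (1/100) (fccRef a₀)` alone (= census ask STAB-61).

THE FOUR INGREDIENTS.
 (1) ZERO STRESS / ZERO FORCE exactly as in P-I(3/3), over `D₃ ∖ 0`: off-diagonal virial entries vanish by coordinate reflections (which preserve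
     the parity of `Σ xₖ`: `sum_negCoord`), diagonal ones agree by coordinate swaps, the trace is `−a⁻¹²Z(12) + a⁻⁶Z(6)` and vanishes at `a₀`
     (`S_a0_eq_zero`, `isStressFree_fcc`); force-freeness by inversion (`isForceFree_fcc`).
 (2) BARLOW IMAGE by an EXPLICIT ROTATION ★ `rot` (columns `(1,1,0)/√2`, `(−1,1,2)/√6`, `(1,−1,1)/√3`; `norm_rot_sq` by `linear_combination` over
     `√2² = 2`, `√3² = 3`; `isometry_rot`): ★ `rot_barlowPos : rot (barlowPos a (a√2√3/3) constHagg k i j) = (a√2/2)·(i+k, i+j, j+k)`, whence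
     ★ `image_rot_fcc : rot '' fccStacking a h = (fccRef (a√2/2)).points` (surjectivity through `unmixM`, the parity inverse of `c ↦ (Σc) − cₖ`) and
     ★★ `isBarlowImage_fcc : 9/10 ≤ a ≤ 11/10 → IsBarlowImage (fccRef (a√2/2)).points` (the tree's window `27/50·a² ≤ h² = 2a²/3 ≤ 121/150·a²`).
 (3) SEPARATION AND LABELLING: distinct points differ by `b·x`, `x ∈ D₃ ∖ 0`, and ★ `two_le_nsq : 2 ≤ |x|²` (parity: `Σxₖ² ≡ Σxₖ (mod 2)`), so
     ★ `fcc_separated : IsSeparatedRef (b√2) (fccRef b)`; ★ `fcc_labelledWithin`: `fccRef b` is labelled by the Barlow image `(fccRef b').points`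
     through the HOMOTHETY `x ↦ (b/b')·x` with strain `|b/b' − 1|` and radius condition `b/b' ≥ 1/2` (so `IsLabelledRef lam ℓ` as soon as
     `|b/b' − 1| ≤ lam`); with `b' = bOf (9/10)` the scale is `t = a₀√2·10/9`.
 (4) THE CERTIFIED WINDOW ★★ `3/5 ≤ a₀√2 ≤ 1` (`three_fifths_le_a0_sqrt2`, `a0_sqrt2_le_one`; numerically `a₀√2 ≈ 0.9712`, not used), by
     ELEMENTARY BOUNDS on the two lattice sums with no enumeration beyond the first shell: `8·Z(12) ≤ Z(6)` termwise from `|x|² ≥ 2`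
     (`eight_mul_epsteinA_le`); `Z(12) ≥ 12·2⁻⁶ = 3/16` from the twelve nearest neighbours (`nnTab`, injective by `decide`, `Summable.sum_le_tsum`);
     and ★ `Z(6) ≤ (2/3)((3.156)³ − 1) ≈ 20.3` (`epsteinB_le`) by the PRODUCT TRICK: AM–GM ★ `(1+x)(1+y)(1+z) ≤ (2/3)(x+y+z)³` for `x+y+z ≥ 2`
     (`prod_le_two_thirds`) gives `|x|⁻⁶ ≤ (2/3)·Πₖ(1+xₖ²)⁻¹`, every finite partial sum sits in a box `[−M, M]³ ∖ 0` where the product weight sums to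
     `T(M)³ − 1` (`Finset.prod_univ_sum`; `sum_g_le`), and the one-dimensional sum obeys ★ `T(M) = 1 + 2·Σ_{k=1}^{M}(1+k²)⁻¹ ≤ 3.156` for EVERY `M`
     (`T_le`: twenty exact terms `U 20 ≤ 1.028` by `norm_num`, then the telescoping tail `(1+k²)⁻¹ ≤ 1/(k−1) − 1/k`, `U_tail` by induction);
     `Real.tsum_le_of_sum_le` closes.  Hence `(3/5)⁶·Z(6) ≤ 0.0467·20.3 < 3/2 ≤ 8·Z(12)`, i.e. `(3/5)⁶ ≤ 8Z(12)/Z(6) = (a₀√2)⁶`, and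
     `t = a₀√2·10/9 ∈ [2/3, 10/9]`: `|t − 1| ≤ 1/3`, `t ≥ 1/2` (`fcc_window`).

WHAT THIS DOES NOT WITNESS.  Harmonic stability modulo rotations `HarmStableModRot (1/100) (fccRef a₀)` — the one remaining hypothesis of (H𝄪ʳ) —
is the census ask STAB-61 / typed leaf (K-v) of P-I(2/2); nothing here bears on it (must-fail probe J2 of the seat checks).  The numerical value of
`a₀` is certified only to the window `[3/5, 1]/√2`.

TAGS.  WITNESS (every theorem PROVED) · imports P-I(2/2) by its future tree name · namespace `…ChargedEnergyGapChartDial.Fcc` (no clash with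
P-I(3/3)'s `…Cubic`: the generic integer-vector vocabulary `vec`, `nsq`, `negCoord`, `swapCoord`, `F` is re-declared here verbatim). -/

noncomputable section
open scoped Classical
open Literature.MathematicalPhysics.StatisticalMechanics
open Literature.Geometry.DiscreteGeometry
open Summit.AtomisticToContinuum.Crystallization.Theses.PricedLinkCensus
open Summit.AtomisticToContinuum.Crystallization.Theorems.ChargedEnergyGapNegative

namespace Summit.AtomisticToContinuum.Crystallization.Theorems.ChargedEnergyGapChartDial

namespace Fcc

/-! ## Integer vectors (generic) -/

section Generic

/-- The vector `b·n`. -/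
def vec (a : ℝ) (n : Fin 3 → ℤ) : E3 := WithLp.toLp 2 fun k => (n k : ℝ) * a

/-- `vec_apply` (docstring added by the landing lane; see the module docstring). [formal bookkeeping] -/
@[simp] theorem vec_apply (a : ℝ) (n : Fin 3 → ℤ) (k : Fin 3) : vec a n k = (n k : ℝ) * a := rfl

/-- `vec_zero` (docstring added by the landing lane; see the module docstring). [formal bookkeeping] -/
theorem vec_zero (a : ℝ) : vec a 0 = 0 := by
  ext k; simp

/-- `vec_eq_zero_iff` (docstring added by the landing lane; see the module docstring). [formal bookkeeping] -/
theorem vec_eq_zero_iff (a : ℝ) (ha : 0 < a) (n : Fin 3 → ℤ) : vec a n = 0 ↔ n = 0 := by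
  constructor
  · intro h
    funext k
    have := congrArg (fun z : E3 => z k) h
    simpa [ha.ne'] using this
  · rintro rfl; exact vec_zero a

/-- `vec_neg` (docstring added by the landing lane; see the module docstring). [formal bookkeeping] -/
theorem vec_neg (a : ℝ) (n : Fin 3 → ℤ) : vec a (-n) = -vec a n := by
  ext k; simp

/-- `nsq` (docstring added by the landing lane; see the module docstring). [formal bookkeeping] -/
def nsq (n : Fin 3 → ℤ) : ℝ := ∑ k, ((n k : ℝ)) ^ 2

/-- `nsq_nonneg` (docstring added by the landing lane; see the module docstring). [formal bookkeeping] -/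
theorem nsq_nonneg (n : Fin 3 → ℤ) : 0 ≤ nsq n := Finset.sum_nonneg fun _ _ => sq_nonneg _

/-- `one_le_nsq_of_ne_zero` (docstring added by the landing lane; see the module docstring). [formal bookkeeping] -/
theorem one_le_nsq_of_ne_zero {n : Fin 3 → ℤ} (hn0 : n ≠ 0) : 1 ≤ nsq n := by
  obtain ⟨k, hk⟩ : ∃ k, n k ≠ 0 := by
    by_contra h
    push Not at h
    exact hn0 (funext h)
  have h1 : (1 : ℝ) ≤ ((n k : ℝ)) ^ 2 := by
    have : (1 : ℤ) ≤ (n k) ^ 2 := by nlinarith [Int.one_le_abs hk, sq_abs (n k)]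
    exact_mod_cast this
  exact h1.trans (Finset.single_le_sum (f := fun k => ((n k : ℝ)) ^ 2) (fun _ _ => sq_nonneg _) (Finset.mem_univ k))

/-- `norm_vec_sq` (docstring added by the landing lane; see the module docstring). [formal bookkeeping] -/
theorem norm_vec_sq (a : ℝ) (n : Fin 3 → ℤ) : ‖vec a n‖ ^ 2 = a ^ 2 * nsq n := by
  rw [EuclideanSpace.real_norm_sq_eq, nsq, Finset.mul_sum]
  exact Finset.sum_congr rfl fun k _ => by rw [vec_apply]; ring

/-- `norm_vec` (docstring added by the landing lane; see the module docstring). [formal bookkeeping] -/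
theorem norm_vec (a : ℝ) (ha : 0 < a) (n : Fin 3 → ℤ) : ‖vec a n‖ = a * Real.sqrt (nsq n) := by
  rw [← Real.sqrt_sq (norm_nonneg _), norm_vec_sq, Real.sqrt_mul (sq_nonneg a), Real.sqrt_sq ha.le]

/-- `dist_zero_vec` (docstring added by the landing lane; see the module docstring). [formal bookkeeping] -/
theorem dist_zero_vec (a : ℝ) (ha : 0 < a) (n : Fin 3 → ℤ) : dist (0 : E3) (vec a n) = a * Real.sqrt (nsq n) := by
  rw [dist_eq_norm, zero_sub, norm_neg, norm_vec a ha]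

/-- `inner_vec` (docstring added by the landing lane; see the module docstring). [formal bookkeeping] -/
theorem inner_vec (a : ℝ) (n : Fin 3 → ℤ) (x : E3) : inner ℝ (vec a n) x = ∑ i, ((n i : ℝ) * a) * x i := by
  simp only [PiLp.inner_apply, Real.inner_apply, vec_apply]

/-- `nsq_neg` (docstring added by the landing lane; see the module docstring). [formal bookkeeping] (dedup gate: a same-shape public twin (BEC …ParsevalShellBootstrap.ir_nsq_neg) lives in an unrelated module; kept PRIVATE here (private copy in part D)) -/
private theorem nsq_neg (n : Fin 3 → ℤ) : nsq (-n) = nsq n := by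
  simp [nsq]

/-- Negating the `i`-th coordinate. -/
def negCoord (i : Fin 3) (n : Fin 3 → ℤ) : Fin 3 → ℤ := fun k => if k = i then -n k else n k

/-- `negCoord_negCoord` (docstring added by the landing lane; see the module docstring). [formal bookkeeping] -/
theorem negCoord_negCoord (i : Fin 3) (n : Fin 3 → ℤ) : negCoord i (negCoord i n) = n := by
  funext k; by_cases hk : k = i <;> simp [negCoord, hk]

/-- `negCoord_ne_zero` (docstring added by the landing lane; see the module docstring). [formal bookkeeping] -/
theorem negCoord_ne_zero (i : Fin 3) {n : Fin 3 → ℤ} (hn : n ≠ 0) : negCoord i n ≠ 0 := fun h =>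
  hn (by rw [← negCoord_negCoord i n, h]; funext k; simp [negCoord])

/-- `nsq_negCoord` (docstring added by the landing lane; see the module docstring). [formal bookkeeping] -/
theorem nsq_negCoord (i : Fin 3) (n : Fin 3 → ℤ) : nsq (negCoord i n) = nsq n := by
  unfold nsq negCoord
  refine Finset.sum_congr rfl fun k _ => ?_
  by_cases hk : k = i <;> simp [hk]

/-- `sum_negCoord` (docstring added by the landing lane; see the module docstring). [formal bookkeeping] -/
theorem sum_negCoord (i : Fin 3) (n : Fin 3 → ℤ) : ∑ k, negCoord i n k = ∑ k, n k - 2 * n i := by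
  fin_cases i <;> simp [negCoord, Fin.sum_univ_three] <;> ring

/-- Swapping coordinates `0` and `i`. -/
def swapCoord (i : Fin 3) (n : Fin 3 → ℤ) : Fin 3 → ℤ := fun k => n (Equiv.swap 0 i k)

/-- `swapCoord_swapCoord` (docstring added by the landing lane; see the module docstring). [formal bookkeeping] -/
theorem swapCoord_swapCoord (i : Fin 3) (n : Fin 3 → ℤ) : swapCoord i (swapCoord i n) = n := by
  funext k; simp [swapCoord, Equiv.swap_apply_self]

/-- `swapCoord_ne_zero` (docstring added by the landing lane; see the module docstring). [formal bookkeeping] -/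
theorem swapCoord_ne_zero (i : Fin 3) {n : Fin 3 → ℤ} (hn : n ≠ 0) : swapCoord i n ≠ 0 := fun h =>
  hn (by rw [← swapCoord_swapCoord i n, h]; funext k; simp [swapCoord])

/-- `nsq_swapCoord` (docstring added by the landing lane; see the module docstring). [formal bookkeeping] -/
theorem nsq_swapCoord (i : Fin 3) (n : Fin 3 → ℤ) : nsq (swapCoord i n) = nsq n := by
  unfold nsq swapCoord
  exact Equiv.sum_comp (Equiv.swap 0 i) (fun k => ((n k : ℝ)) ^ 2)

/-- `sum_swapCoord` (docstring added by the landing lane; see the module docstring). [formal bookkeeping] -/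
theorem sum_swapCoord (i : Fin 3) (n : Fin 3 → ℤ) : ∑ k, swapCoord i n k = ∑ k, n k := by
  unfold swapCoord
  exact Equiv.sum_comp (Equiv.swap 0 i) (fun k => n k)

/-- The radial pair function `F(d) = V′(d)/d`. -/
def F (d : ℝ) : ℝ := ljD1 d / d

/-- `F_mul_sq` (docstring added by the landing lane; see the module docstring). [formal bookkeeping] -/
theorem F_mul_sq {d : ℝ} (hd : 0 < d) : F d * d ^ 2 = -(d⁻¹) ^ 12 + (d⁻¹) ^ 6 := by
  unfold F ljD1
  field_simp

/-- `abs_F_mul_sq_le` (docstring added by the landing lane; see the module docstring). [formal bookkeeping] -/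
theorem abs_F_mul_sq_le {d : ℝ} (hd : 0 < d) : |F d| * d ^ 2 ≤ (d⁻¹) ^ 12 + (d⁻¹) ^ 6 := by
  have h : |F d| * d ^ 2 = |F d * d ^ 2| := by
    rw [abs_mul, abs_of_pos (pow_pos hd 2)]
  rw [h, F_mul_sq hd]
  have h1 : 0 ≤ (d⁻¹) ^ 12 := pow_nonneg (inv_nonneg.2 hd.le) _
  have h2 : 0 ≤ (d⁻¹) ^ 6 := pow_nonneg (inv_nonneg.2 hd.le) _
  exact (abs_add_le _ _).trans (by rw [abs_neg, abs_of_nonneg h1, abs_of_nonneg h2])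

end Generic

/-! ## The fcc lattice `b·D₃` (cubic coordinates) with one-point motif -/

section Fcc

/-- The primitive vectors `v_i = b·(1,1,1) − b·e_i`. -/
def fccVec (b : ℝ) (i : Fin 3) : E3 := WithLp.toLp 2 fun k => if k = i then 0 else b

/-- `fccVec_apply` (docstring added by the landing lane; see the module docstring). [formal bookkeeping] -/
@[simp] theorem fccVec_apply (b : ℝ) (i k : Fin 3) : fccVec b i k = if k = i then 0 else b := rfl

/-- `fccVec_li` (docstring added by the landing lane; see the module docstring). [formal bookkeeping] -/
theorem fccVec_li (b : ℝ) (hb : 0 < b) : LinearIndependent ℝ (fccVec b) := by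
  rw [Fintype.linearIndependent_iff]
  intro g hg
  have h0 := congrArg (fun z : E3 => z 0) hg
  have h1 := congrArg (fun z : E3 => z 1) hg
  have h2 := congrArg (fun z : E3 => z 2) hg
  simp [Fin.sum_univ_three] at h0 h1 h2
  have hb0 := hb.ne'
  intro i
  fin_cases i
  · have : (g 1 + g 2) * b = 0 := by linarith
    have : (g 0 + g 2) * b = 0 := by linarith
    have e1 : g 1 + g 2 = 0 := (mul_eq_zero.1 ‹(g 1 + g 2) * b = 0›).resolve_right hb0
    have e2 : g 0 + g 2 = 0 := (mul_eq_zero.1 this).resolve_right hb0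
    have : (g 0 + g 1) * b = 0 := by linarith
    have e3 : g 0 + g 1 = 0 := (mul_eq_zero.1 this).resolve_right hb0
    simp; linarith
  · have : (g 1 + g 2) * b = 0 := by linarith
    have e1 : g 1 + g 2 = 0 := (mul_eq_zero.1 this).resolve_right hb0
    have : (g 0 + g 2) * b = 0 := by linarith
    have e2 : g 0 + g 2 = 0 := (mul_eq_zero.1 this).resolve_right hb0
    have : (g 0 + g 1) * b = 0 := by linarith
    have e3 : g 0 + g 1 = 0 := (mul_eq_zero.1 this).resolve_right hb0
    simp; linarith
  · have : (g 1 + g 2) * b = 0 := by linarith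
    have e1 : g 1 + g 2 = 0 := (mul_eq_zero.1 this).resolve_right hb0
    have : (g 0 + g 2) * b = 0 := by linarith
    have e2 : g 0 + g 2 = 0 := (mul_eq_zero.1 this).resolve_right hb0
    have : (g 0 + g 1) * b = 0 := by linarith
    have e3 : g 0 + g 1 = 0 := (mul_eq_zero.1 this).resolve_right hb0
    simp; linarith

/-- `M c = (Σ c) − c` : the integer coordinates of `Σ c_i v_i`. -/
def mixM (c : Fin 3 → ℤ) : Fin 3 → ℤ := fun k => (∑ i, c i) - c k

/-- `sum_smul_fccVec` (docstring added by the landing lane; see the module docstring). [formal bookkeeping] -/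
theorem sum_smul_fccVec (b : ℝ) (c : Fin 3 → ℝ) :
    ∑ i, c i • fccVec b i = WithLp.toLp 2 fun k => ((∑ i, c i) - c k) * b := by
  ext k
  fin_cases k <;> simp [Fin.sum_univ_three] <;> ring

/-- `sum_zsmul_fccVec` (docstring added by the landing lane; see the module docstring). [formal bookkeeping] -/
theorem sum_zsmul_fccVec (b : ℝ) (c : Fin 3 → ℤ) : ∑ i, (c i : ℝ) • fccVec b i = vec b (mixM c) := by
  rw [sum_smul_fccVec]
  ext k
  simp [mixM]

/-- `fccVec_span` (docstring added by the landing lane; see the module docstring). [formal bookkeeping] -/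
theorem fccVec_span (b : ℝ) (hb : 0 < b) : ⊤ ≤ Submodule.span ℝ (Set.range (fccVec b)) := by
  intro x _
  rw [Submodule.mem_span_range_iff_exists_fun]
  refine ⟨fun i => ((∑ k, x k) / 2 - x i) / b, ?_⟩
  rw [sum_smul_fccVec]
  ext k
  fin_cases k <;> simp [Fin.sum_univ_three] <;> field_simp <;> ring

/-- The fcc basis. -/
def fccBasis (b : ℝ) (hb : 0 < b) : Module.Basis (Fin 3) ℝ E3 := Module.Basis.mk (fccVec_li b hb) (fccVec_span b hb)

/-- `fccBasis_apply` (docstring added by the landing lane; see the module docstring). [formal bookkeeping] -/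
@[simp] theorem fccBasis_apply (b : ℝ) (hb : 0 < b) (i : Fin 3) : fccBasis b hb i = fccVec b i :=
  Module.Basis.mk_apply (fccVec_li b hb) (fccVec_span b hb) i

/-- The fcc periodic configuration `b·D₃` (lattice spanned by the `v_i`, one-point motif `{0}`). -/
def fccRef (b : ℝ) (hb : 0 < b) : PeriodicConfiguration 3 where
  lattice := Submodule.span ℤ (Set.range (fccBasis b hb))
  discrete := inferInstance
  isZLattice := inferInstance
  motif := {0}
  motif_nonempty := by simp
  eq_of_sub_mem := by
    intro x hx y hy _
    simp only [Finset.mem_singleton] at hx hy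
    rw [hx, hy]

/-- `fccRef_motif` (docstring added by the landing lane; see the module docstring). [formal bookkeeping] -/
theorem fccRef_motif (b : ℝ) (hb : 0 < b) : (fccRef b hb).motif = {0} := rfl

/-- `mem_lattice_iff` (docstring added by the landing lane; see the module docstring). [formal bookkeeping] -/
theorem mem_lattice_iff (b : ℝ) (hb : 0 < b) (z : E3) :
    z ∈ (fccRef b hb).lattice ↔ ∃ c : Fin 3 → ℤ, z = vec b (mixM c) := by
  change z ∈ Submodule.span ℤ (Set.range (fccBasis b hb)) ↔ _
  rw [Submodule.mem_span_range_iff_exists_fun]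
  constructor
  · rintro ⟨c, rfl⟩
    refine ⟨c, ?_⟩
    rw [← sum_zsmul_fccVec]
    exact Finset.sum_congr rfl fun i _ => by rw [fccBasis_apply, Int.cast_smul_eq_zsmul]
  · rintro ⟨c, rfl⟩
    refine ⟨c, ?_⟩
    rw [← sum_zsmul_fccVec]
    exact Finset.sum_congr rfl fun i _ => by rw [fccBasis_apply, Int.cast_smul_eq_zsmul]

/-- `mem_points_iff_lattice` (docstring added by the landing lane; see the module docstring). [formal bookkeeping] -/
theorem mem_points_iff_lattice (b : ℝ) (hb : 0 < b) (z : E3) : z ∈ (fccRef b hb).points ↔ z ∈ (fccRef b hb).lattice := by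
  constructor
  · rintro ⟨y, hy, g, hg, rfl⟩
    rw [fccRef_motif, Finset.mem_singleton] at hy
    rw [hy, zero_add]; exact hg
  · intro hz
    exact ⟨0, by simp [fccRef_motif], z, hz, by simp⟩

/-- `sum_mixM` (docstring added by the landing lane; see the module docstring). [formal bookkeeping] -/
theorem sum_mixM (c : Fin 3 → ℤ) : ∑ k, mixM c k = 2 * ∑ i, c i := by
  simp [mixM, Finset.sum_sub_distrib, Fin.sum_univ_three]; ring

/-- `even_sum_mixM` (docstring added by the landing lane; see the module docstring). [formal bookkeeping] -/
theorem even_sum_mixM (c : Fin 3 → ℤ) : Even (∑ k, mixM c k) := ⟨∑ i, c i, by rw [sum_mixM]; ring⟩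

/-- The inverse coordinates (valid on even-sum vectors). -/
def unmixM (x : Fin 3 → ℤ) : Fin 3 → ℤ := fun k => (∑ i, x i) / 2 - x k

/-- `mixM_unmixM` (docstring added by the landing lane; see the module docstring). [formal bookkeeping] -/
theorem mixM_unmixM {x : Fin 3 → ℤ} (hx : Even (∑ k, x k)) : mixM (unmixM x) = x := by
  obtain ⟨m, hm⟩ := hx
  have hdiv : (∑ i, x i) / 2 = m := by omega
  have hsum : ∑ i, unmixM x i = m := by
    simp only [unmixM, Finset.sum_sub_distrib, Finset.sum_const, Finset.card_univ, Fintype.card_fin, hdiv, nsmul_eq_mul]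
    push_cast
    omega
  funext k
  show (∑ i, unmixM x i) - unmixM x k = x k
  rw [hsum]
  simp only [unmixM, hdiv]
  omega

/-- ★ The points of the fcc configuration are exactly the vectors `b·x` with `x ∈ ℤ³` of EVEN coordinate sum (`D₃`). -/
theorem mem_points_iff_even (b : ℝ) (hb : 0 < b) (z : E3) :
    z ∈ (fccRef b hb).points ↔ ∃ x : Fin 3 → ℤ, Even (∑ k, x k) ∧ z = vec b x := by
  rw [mem_points_iff_lattice, mem_lattice_iff]
  constructor
  · rintro ⟨c, rfl⟩; exact ⟨mixM c, even_sum_mixM c, rfl⟩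
  · rintro ⟨x, hx, rfl⟩; exact ⟨unmixM x, by rw [mixM_unmixM hx]⟩

/-- `vec_mem_points` (docstring added by the landing lane; see the module docstring). [formal bookkeeping] -/
theorem vec_mem_points {b : ℝ} (hb : 0 < b) {x : Fin 3 → ℤ} (hx : Even (∑ k, x k)) : vec b x ∈ (fccRef b hb).points :=
  (mem_points_iff_even b hb _).2 ⟨x, hx, rfl⟩

/-- `D₃ ∖ 0`. -/
abbrev D3 := {n : Fin 3 → ℤ // n ≠ 0 ∧ Even (∑ k, n k)}

/-- `one_le_nsq` (docstring added by the landing lane; see the module docstring). [formal bookkeeping] -/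
theorem one_le_nsq (n : D3) : 1 ≤ nsq n.1 := one_le_nsq_of_ne_zero n.2.1

/-- `nsq_pos` (docstring added by the landing lane; see the module docstring). [formal bookkeeping] -/
theorem nsq_pos (n : D3) : 0 < nsq n.1 := lt_of_lt_of_le one_pos (one_le_nsq n)

/-- ★ `D₃ ∖ 0 ≃` the non-zero points of the fcc configuration. -/
def vecEquiv (b : ℝ) (hb : 0 < b) : D3 ≃ {z : E3 // z ∈ (fccRef b hb).points ∧ z ≠ 0} where
  toFun n := ⟨vec b n.1, vec_mem_points hb n.2.2, fun h => n.2.1 ((vec_eq_zero_iff b hb n.1).1 h)⟩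
  invFun z := ⟨fun k => round (z.1 k / b), by
    obtain ⟨x, hx, hzx⟩ := (mem_points_iff_even b hb z.1).1 z.2.1
    have hfun : (fun k => round (z.1 k / b)) = x := by
      funext k; rw [hzx, vec_apply, mul_div_cancel_right₀ _ hb.ne', round_intCast]
    rw [hfun]
    exact ⟨fun h => z.2.2 (by rw [hzx, h, vec_zero]), hx⟩⟩
  left_inv n := by
    apply Subtype.ext
    funext k
    simp [mul_div_cancel_right₀ _ hb.ne', round_intCast]
  right_inv z := by
    obtain ⟨x, hx, hzx⟩ := (mem_points_iff_even b hb z.1).1 z.2.1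
    apply Subtype.ext
    simp only
    have hfun : (fun k => round (z.1 k / b)) = x := by
      funext k; rw [hzx, vec_apply, mul_div_cancel_right₀ _ hb.ne', round_intCast]
    rw [hfun, hzx]

/-- `vecEquiv_apply` (docstring added by the landing lane; see the module docstring). [formal bookkeeping] -/
@[simp] theorem vecEquiv_apply (b : ℝ) (hb : 0 < b) (n : D3) : ((vecEquiv b hb n) : E3) = vec b n.1 := rfl

end Fcc

end Fcc

end Summit.AtomisticToContinuum.Crystallization.Theorems.ChargedEnergyGapChartDial

end
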